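/-
Copyright (c) 2026 the pub-hodgecm-mathlib formalisation cell (harness21).  Prover seat hodgecm-mathlib-K2E3-p12 (g4), Track B «K2-LIT» ∕ h413
(`stmt-HodgeConjecture-24833`), line `K2_E3_EllipticInputs`, unit U12-d, §L (S2c): UNIQUENESS ON THE REGULAR NILPOTENT ORBIT — an invariant distribution on
`𝔤𝔩₂(F)` supported in the nilpotent cone is `c·μ_reg` on the test functions vanishing near `0`; hence (LBGL-2a) `J(𝒩)(𝔤𝔩₂(F)) = ℂδ₀ ⊕ ℂμ_reg`.  2026-09-04.
-/
import Summits.HodgeConjecture.HodgeConjecture.Theorems.K2E3GL2RegularNilpotentOrbitSpace          -- S2b (this seat): the orbit `↥(orbit (ConjAct GL₂(F)) E₁₂)` and `μ = val^* ν`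
import Summits.HodgeConjecture.HodgeConjecture.Theorems.K2E3GL2NilpotentStructureOfPuncturedCone    -- ★ p856851 (K2E3-p12 g3): (a) ⟸ (a-orb)
import Literature.MeasureTheory.Group.InvariantFunctionalLocallyConstant                           -- ★ COINV-1 (additive form) + rider `isOpenPosMeasure_of_smulInvariantMeasure_ne_zero`
import Literature.MeasureTheory.Group.ConjClassLocallyClosedEmbedding                              -- ★ `continuousSMul_orbit` (Glimm–Effros packaging of Mathlib's open-mapping theorem)
import Literature.Topology.LocallyConstantExtend                                                   -- ★ `exists_isLocallyConstant_hasCompactSupport_extend`, `exists_isCompact_isOpen_mem_subset`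
import Literature.Topology.Algebra.CompactOpenSubgroupOfLocallyCompact                             -- ★ van Dantzig `exists_isCompact_isOpen_subgroup`
import Mathlib.Topology.Algebra.Group.OpenMapping
import HarnessLib

/-!
# K2_E3 road (h413), §L — S2c: uniqueness of invariant distributions on the regular nilpotent orbit of `𝔤𝔩₂(F)`; (LBGL-2a)

Cell `pub/hodgecm-mathlib` (D-0151), Track B, seat K2E3-p12 (g4), §L line lead (dealer K2E3-plan (g2), D41).  `--supports stmt-HodgeConjecture-24833 --as helper`;
THEOREMS ONLY (no definition ∕ instance ∕ notation ∕ named fact ∕ `sorry`); never imports `Cruxes/…/Lines`.  COUNT-NEUTRAL until :310 closes.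

THE STATEMENT (LBGL-2a′) (`gl2_nilpotentUniqueness_off_zero`).  `F` a non-archimedean local field, `(κ, dx)` a Haar pair on `GL₂(𝒪_F) × F`, `T` a functional on
`C_c^∞(𝔤𝔩₂(F))` with the four `J(𝒩)` clauses of (L-B_GL) (additive, homogeneous, `Ad(GL₂(F))`-invariant, vanishing on test functions whose support meets no
nilpotent).  THEN `∃ c, ∀ f ∈ C_c^∞(𝔤𝔩₂(F))` with `0 ∉ tsupport f`, `T f = c · μ_reg^{κ,dx}(f)`, `μ_reg(f) = ∫ f(k (tE₁₂) k⁻¹) d(κ ⊗ dx)`.  With ★ p856851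
`gl2_nilpotentStructure_of_puncturedCone` this gives (LBGL-2a) **`gl2_nilpotentStructure`** — `T = a·δ₀ + b·μ_reg` on `C_c^∞(𝔤𝔩₂(F))` — whose statement is the
U12 ED. 8 leaf `sig_K2E3GL2NilpotentStructure` TOKEN FOR TOKEN (dealer cand `U12_LBGL_leaves.cand.v1` 331b9937, r01 PRE-BOX 02:55:52Z).
[HarishChandra1999AdmissibleDistributions, §3 Thm. 3.9, Cor. 3.10 p. 10: `dim J(𝒩)` = number of nilpotent orbits]; [Howe1974, Prop. 2]; [BernsteinZelevinsky1976, §1.18].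

THE PROOF (Howe ∕ Harish-Chandra, the one-orbit step).  `X := ↥(orbit (ConjAct GL₂(F)) E₁₂) = 𝒩 ∖ {0}` (★ S2b `mem_orbit_nilpOne_iff`) is locally closed, hence
locally compact and Baire; `G := ConjAct (GL (Fin 2) F)` (a σ-compact totally disconnected locally compact group, topologised as `GL₂(F)`) acts on it continuously and
transitively with OPEN orbit maps (Mathlib `isOpenMap_smul_of_sigmaCompact`); `μ := val^* ν` is invariant, finite on compacta (★ S2b) and positive on opens (★ rider).
§1: every `φ ∈ S(X)` extends to `Φ ∈ C_c^∞(𝔤𝔩₂(F))` VANISHING NEAR `0` (★ Bernstein–Zelevinsky extension, then cut off by a compact open neighbourhood of `0` missing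
the compact `val(tsupport φ) ∌ 0`), and two such extensions have the same `T`-value (their difference is a test function vanishing on `X` and near `0`, i.e. on `𝒩`:
clause (iv)).  §2: so `T̄ φ := T Φ` is a well-defined additive homogeneous `G`-invariant functional on `S(X)` (clauses (i)–(iii)), ★ COINV-1 gives `T̄ = c·μ`, and
for `f ∈ C_c^∞(𝔤𝔩₂(F))` with `0 ∉ tsupport f` the restriction `f∘val ∈ S(X)` has `f` itself as extension: `T f = T̄(f∘val) = c ∫_X f∘val dμ = c·μ_reg(f)`
(★ S2b `integral_comp_val_comap_val`).  §3: (LBGL-2a) by ★ p856851.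

References: [HarishChandra1999AdmissibleDistributions] Harish-Chandra (DeBacker–Sally), AMS ULECT 16 (1999), §3 pp. 8–10, Thm. 3.9, Cor. 3.10 · [Howe1974] R. Howe,
Math. Ann. 208 (1974), Prop. 2 · [BernsteinZelevinsky1976] Russian Math. Surveys 31:3 (1976), Prop. 1.8, §1.18 · [RangaRao1972] Ann. of Math. 96 (1972).
-/

set_option autoImplicit false
set_option linter.dupNamespace false   -- `Summit.HodgeConjecture.HodgeConjecture.…` (D-0017 nested layout; lakefile exemption for Summits)

noncomputable section

open MeasureTheory Measure Filter Topology TopologicalSpace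
open scoped MatrixGroups NNReal ENNReal
open Literature.NumberTheory.Rogawski1990 Literature.NumberTheory.Automorphic Literature.NumberTheory.Automorphic.LocalFieldHaar
open Literature.NumberTheory.GaloisRepresentations Literature.NumberTheory.GaloisRepresentations.IsNonarchimedeanLocalField
open Summit.HodgeConjecture.HodgeConjecture.Cruxes.H413.K2E3GL2RegularNilpotentOrbitalMeasure
open Summit.HodgeConjecture.HodgeConjecture.Cruxes.H413.K2E3GL2RegularNilpotentOrbitStructure
open Summit.HodgeConjecture.HodgeConjecture.Cruxes.H413.K2E3GL2RegularNilpotentOrbitPushforward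
open Summit.HodgeConjecture.HodgeConjecture.Cruxes.H413.K2E3GL2RegularNilpotentOrbitSpace
open Summit.HodgeConjecture.HodgeConjecture.Cruxes.H413.K2E3GL2NilpotentStructureOfPuncturedCone

namespace Summit.HodgeConjecture.HodgeConjecture.Cruxes.H413.K2E3GL2NilpotentOneOrbitUniqueness

variable {F : Type*} [Field F] [ValuativeRel F] [TopologicalSpace F] [IsNonarchimedeanLocalField F]

/-! ## §1  Test functions on `𝔤𝔩₂(F)` versus test functions on the orbit `X = 𝒩 ∖ {0}` -/

/-- **Restriction.**  For `f ∈ C_c^∞(𝔤𝔩₂(F))` with `0 ∉ tsupport f`, the restriction `f ∘ val` to the orbit has compact support (`tsupport f ∩ X = tsupport f ∩ closure X`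
is compact, the closure of the orbit being `X ∪ {0}`, ★ `closure_orbit_nilpOne_subset`). [cite: BernsteinZelevinsky1976, §1.1] [cite: HarishChandra1999AdmissibleDistributions, §3 p. 10] -/
theorem hasCompactSupport_comp_val {f : Matrix (Fin 2) (Fin 2) F → ℂ} (hf : IsLocSmooth f) (h0 : (0 : Matrix (Fin 2) (Fin 2) F) ∉ tsupport f) :
    HasCompactSupport fun x : ↥(MulAction.orbit (ConjAct (GL (Fin 2) F)) (!![0, 1; 0, 0] : Matrix (Fin 2) (Fin 2) F)) => f (x : Matrix (Fin 2) (Fin 2) F) := by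
  haveI : T2Space F := (isLocalField F).toT2Space
  have hc : IsCompact ((Subtype.val : ↥(MulAction.orbit (ConjAct (GL (Fin 2) F)) (!![0, 1; 0, 0] : Matrix (Fin 2) (Fin 2) F)) →
      Matrix (Fin 2) (Fin 2) F) ⁻¹' tsupport f) := by
    rw [Subtype.isCompact_iff]
    have heq : (Subtype.val : ↥(MulAction.orbit (ConjAct (GL (Fin 2) F)) (!![0, 1; 0, 0] : Matrix (Fin 2) (Fin 2) F)) → Matrix (Fin 2) (Fin 2) F) ''
        ((Subtype.val : ↥(MulAction.orbit (ConjAct (GL (Fin 2) F)) (!![0, 1; 0, 0] : Matrix (Fin 2) (Fin 2) F)) → Matrix (Fin 2) (Fin 2) F) ⁻¹' tsupport f) =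
        tsupport f ∩ closure (MulAction.orbit (ConjAct (GL (Fin 2) F)) (!![0, 1; 0, 0] : Matrix (Fin 2) (Fin 2) F)) := by
      rw [Set.image_preimage_eq_inter_range, Subtype.range_coe]
      apply Set.Subset.antisymm
      · exact Set.inter_subset_inter_right _ subset_closure
      · rintro X ⟨hX, hXc⟩
        refine ⟨hX, ?_⟩
        rcases closure_orbit_nilpOne_subset hXc with h | h
        · exact absurd hX (by rw [h]; exact h0)
        · exact h
    rw [heq]
    exact hf.2.inter_right isClosed_closure
  exact HasCompactSupport.of_support_subset_isCompact hc fun x hx => subset_tsupport f hx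

/-- **Extension off `0`.**  Every locally constant compactly supported `φ` on the orbit `X` extends to `Φ ∈ C_c^∞(𝔤𝔩₂(F))` with `Φ ∘ val = φ` AND `0 ∉ tsupport Φ`:
extend by ★ `Literature.Topology.exists_isLocallyConstant_hasCompactSupport_extend` (Bernstein–Zelevinsky Prop. 1.8), then multiply by the indicator of the
complement of a compact open neighbourhood of `0` missing the compact set `val(tsupport φ) ∌ 0`. [cite: BernsteinZelevinsky1976, Prop. 1.8]
[cite: HarishChandra1999AdmissibleDistributions, §3 p. 10] -/
theorem exists_isLocSmooth_extend_off_zero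
    (φ : ↥(MulAction.orbit (ConjAct (GL (Fin 2) F)) (!![0, 1; 0, 0] : Matrix (Fin 2) (Fin 2) F)) → ℂ) (hφ : IsLocallyConstant φ) (hφs : HasCompactSupport φ) :
    ∃ Φ : Matrix (Fin 2) (Fin 2) F → ℂ, IsLocSmooth Φ ∧ (0 : Matrix (Fin 2) (Fin 2) F) ∉ tsupport Φ ∧
      ∀ x : ↥(MulAction.orbit (ConjAct (GL (Fin 2) F)) (!![0, 1; 0, 0] : Matrix (Fin 2) (Fin 2) F)), Φ (x : Matrix (Fin 2) (Fin 2) F) = φ x := by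
  haveI : T2Space F := (isLocalField F).toT2Space
  haveI : LocallyCompactSpace F := (isLocalField F).toLocallyCompactSpace
  haveI : LocallyCompactSpace (Matrix (Fin 2) (Fin 2) F) := Pi.locallyCompactSpace_of_finite
  haveI : TotallyDisconnectedSpace F := totallyDisconnectedSpace_of_isNonarchimedeanLocalField F
  haveI : TotallyDisconnectedSpace (Matrix (Fin 2) (Fin 2) F) := inferInstanceAs (TotallyDisconnectedSpace (Fin 2 → Fin 2 → F))
  obtain ⟨Φ₀, hΦ₀, hΦ₀s, hΦ₀φ⟩ := Literature.Topology.exists_isLocallyConstant_hasCompactSupport_extend hφ hφs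
  -- the compact set `K = val(tsupport φ)`, which misses `0`
  have hKc : IsCompact ((Subtype.val : ↥(MulAction.orbit (ConjAct (GL (Fin 2) F)) (!![0, 1; 0, 0] : Matrix (Fin 2) (Fin 2) F)) → Matrix (Fin 2) (Fin 2) F) ''
      tsupport φ) := hφs.isCompact.image continuous_subtype_val
  have h0K : (0 : Matrix (Fin 2) (Fin 2) F) ∉ (Subtype.val : ↥(MulAction.orbit (ConjAct (GL (Fin 2) F)) (!![0, 1; 0, 0] : Matrix (Fin 2) (Fin 2) F)) →
      Matrix (Fin 2) (Fin 2) F) '' tsupport φ := by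
    rintro ⟨x, -, hx⟩
    exact zero_notMem_orbit_nilpOne (F := F) (hx ▸ x.2)
  -- a compact open `Λ ∋ 0` missing `K`
  obtain ⟨Λ, hΛc, hΛo, h0Λ, hΛK⟩ := Literature.Topology.exists_isCompact_isOpen_mem_subset hKc.isClosed.isOpen_compl h0K
  refine ⟨Λᶜ.indicator Φ₀, IsLocSmooth.indicator ⟨hΦ₀, hΦ₀s⟩ ⟨hΛo.isClosed_compl, hΛc.isClosed.isOpen_compl⟩, ?_, fun x => ?_⟩
  · refine notMem_tsupport_iff_eventuallyEq.2 (Filter.eventually_of_mem (hΛo.mem_nhds h0Λ) fun Y hY => ?_)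
    exact Set.indicator_of_notMem (Set.notMem_compl_iff.2 hY) _
  · by_cases hx : (x : Matrix (Fin 2) (Fin 2) F) ∈ Λ
    · rw [Set.indicator_of_notMem (Set.notMem_compl_iff.2 hx)]
      symm
      refine image_eq_zero_of_notMem_tsupport fun hxs => hΛK hx ⟨x, hxs, rfl⟩
    · rw [Set.indicator_of_mem (Set.mem_compl hx), hΦ₀φ x]

omit [ValuativeRel F] [IsNonarchimedeanLocalField F] in
/-- **Clause (iv) on the orbit**: a test function `D` on `𝔤𝔩₂(F)` vanishing on the orbit `X` and near `0` vanishes on the whole nilpotent cone `𝒩 = X ∪ {0}`, so `T D = 0`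
for every `T` with clause (iv) of `J(𝒩)`. [cite: HarishChandra1999AdmissibleDistributions, §3 p. 10, Cor. 3.10] -/
theorem apply_eq_zero_of_forall_comp_val_eq_zero {T : (Matrix (Fin 2) (Fin 2) F → ℂ) → ℂ}
    (hT4 : ∀ f : Matrix (Fin 2) (Fin 2) F → ℂ, IsLocSmooth f → (∀ X ∈ tsupport f, ¬ IsNilpotent X) → T f = 0)
    {D : Matrix (Fin 2) (Fin 2) F → ℂ} (hD : IsLocSmooth D) (h0 : (0 : Matrix (Fin 2) (Fin 2) F) ∉ tsupport D)
    (hDX : ∀ x : ↥(MulAction.orbit (ConjAct (GL (Fin 2) F)) (!![0, 1; 0, 0] : Matrix (Fin 2) (Fin 2) F)), D (x : Matrix (Fin 2) (Fin 2) F) = 0) :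
    T D = 0 := by
  refine hT4 D hD fun X hX hnil => ?_
  rw [tsupport_eq_support_of_isLocallyConstant hD.1, Function.mem_support] at hX
  rcases eq_zero_or_mem_orbit_nilpOne_of_isNilpotent hnil with h | h
  · rw [h] at hX
    exact hX (image_eq_zero_of_notMem_tsupport h0)
  · exact hX (hDX ⟨X, h⟩)

omit [ValuativeRel F] [IsNonarchimedeanLocalField F] in
/-- **Two extensions off `0` of the same `φ ∈ S(X)` have the same `T`-value** (clauses (i) and (iv)). [cite: HarishChandra1999AdmissibleDistributions, §3 p. 10] -/
theorem apply_eq_apply_of_forall_comp_val_eq {T : (Matrix (Fin 2) (Fin 2) F → ℂ) → ℂ}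
    (hT1 : ∀ f₁ f₂ : Matrix (Fin 2) (Fin 2) F → ℂ, IsLocSmooth f₁ → IsLocSmooth f₂ → T (f₁ + f₂) = T f₁ + T f₂)
    (hT4 : ∀ f : Matrix (Fin 2) (Fin 2) F → ℂ, IsLocSmooth f → (∀ X ∈ tsupport f, ¬ IsNilpotent X) → T f = 0)
    {Φ₁ Φ₂ : Matrix (Fin 2) (Fin 2) F → ℂ} (h₁ : IsLocSmooth Φ₁) (h₂ : IsLocSmooth Φ₂)
    (h₁0 : (0 : Matrix (Fin 2) (Fin 2) F) ∉ tsupport Φ₁) (h₂0 : (0 : Matrix (Fin 2) (Fin 2) F) ∉ tsupport Φ₂)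
    (h : ∀ x : ↥(MulAction.orbit (ConjAct (GL (Fin 2) F)) (!![0, 1; 0, 0] : Matrix (Fin 2) (Fin 2) F)),
      Φ₁ (x : Matrix (Fin 2) (Fin 2) F) = Φ₂ (x : Matrix (Fin 2) (Fin 2) F)) :
    T Φ₁ = T Φ₂ := by
  have h0 : (0 : Matrix (Fin 2) (Fin 2) F) ∉ tsupport (Φ₁ - Φ₂) := by
    rw [notMem_tsupport_iff_eventuallyEq] at h₁0 h₂0 ⊢
    exact (h₁0.and h₂0).mono fun Y hY => by
      simp only [Pi.sub_apply, Pi.zero_apply] at hY ⊢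
      rw [hY.1, hY.2, sub_zero]
  have hD := apply_eq_zero_of_forall_comp_val_eq_zero hT4 (h₁.sub h₂) h0 fun x => by rw [Pi.sub_apply, h x, sub_self]
  calc T Φ₁ = T (Φ₂ + (Φ₁ - Φ₂)) := by rw [add_sub_cancel]
    _ = T Φ₂ + T (Φ₁ - Φ₂) := hT1 _ _ h₂ (h₁.sub h₂)
    _ = T Φ₂ := by rw [hD, add_zero]

/-! ## §2  (LBGL-2a′): uniqueness on the punctured nilpotent cone -/

set_option maxHeartbeats 800000 in
/-- **(LBGL-2a′) UNIQUENESS OF INVARIANT DISTRIBUTIONS ON THE REGULAR NILPOTENT ORBIT OF `𝔤𝔩₂(F)`.**  For a Haar pair `(κ, dx)` on `GL₂(𝒪_F) × F` and every functional `T`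
on `C_c^∞(𝔤𝔩₂(F))` with the four `J(𝒩)` clauses of (L-B_GL) — (i) additive, (ii) homogeneous, (iii) `Ad(GL₂(F))`-invariant, (iv) zero on test functions whose
support meets no nilpotent — there is `c` with `T f = c · ∫ f(k (tE₁₂) k⁻¹) d(κ ⊗ dx)` for every `f ∈ C_c^∞(𝔤𝔩₂(F))` with `0 ∉ tsupport f`.  (Howe's one-orbit step:
`T̄ φ := T(extension of φ off 0)` is an invariant functional on `S(𝒩 ∖ {0})`, and `𝒩 ∖ {0}` is ONE `GL₂(F)`-orbit carrying the invariant Radon measure `val^* ν`;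
★ COINV-1.) [cite: HarishChandra1999AdmissibleDistributions, Thm. 3.9, Cor. 3.10 p. 10] [cite: Howe1974, Prop. 2] [cite: BernsteinZelevinsky1976, §1.18] -/
theorem gl2_nilpotentUniqueness_off_zero [MeasurableSpace F] [BorelSpace F] [MeasurableSpace (GL (Fin 2) F)] [BorelSpace (GL (Fin 2) F)]
    (κ : Measure ↥(glInt 2 F)) [IsHaarMeasure κ] (dx : Measure F) [dx.IsAddHaarMeasure]
    (T : (Matrix (Fin 2) (Fin 2) F → ℂ) → ℂ)
    (hT : (∀ f₁ f₂ : Matrix (Fin 2) (Fin 2) F → ℂ, IsLocSmooth f₁ → IsLocSmooth f₂ → T (f₁ + f₂) = T f₁ + T f₂) ∧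
       (∀ (a : ℂ) (f : Matrix (Fin 2) (Fin 2) F → ℂ), IsLocSmooth f → T (a • f) = a * T f) ∧
       (∀ (x : GL (Fin 2) F) (f : Matrix (Fin 2) (Fin 2) F → ℂ), IsLocSmooth f →
          T (fun X => f ((x : Matrix (Fin 2) (Fin 2) F) * X * ((x⁻¹ : GL (Fin 2) F) : Matrix (Fin 2) (Fin 2) F))) = T f) ∧
       (∀ f : Matrix (Fin 2) (Fin 2) F → ℂ, IsLocSmooth f → (∀ X ∈ tsupport f, ¬ IsNilpotent X) → T f = 0)) :
    ∃ c : ℂ, ∀ f : Matrix (Fin 2) (Fin 2) F → ℂ, IsLocSmooth f → (0 : Matrix (Fin 2) (Fin 2) F) ∉ tsupport f →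
      T f = c * ∫ p : ↥(glInt 2 F) × F, f (((p.1 : GL (Fin 2) F) : Matrix (Fin 2) (Fin 2) F) * !![0, p.2; 0, 0] *
        ((((p.1 : GL (Fin 2) F))⁻¹ : GL (Fin 2) F) : Matrix (Fin 2) (Fin 2) F)) ∂(κ.prod dx) := by
  classical
  obtain ⟨hT1, hT2, hT3, hT4⟩ := hT
  -- topology of `F`, `𝔤𝔩₂(F)`, `GL₂(F)`
  haveI : T2Space F := (isLocalField F).toT2Space
  haveI : LocallyCompactSpace F := (isLocalField F).toLocallyCompactSpace
  haveI : SecondCountableTopology F := secondCountableTopology_localField F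
  haveI : TotallyDisconnectedSpace F := totallyDisconnectedSpace_of_isNonarchimedeanLocalField F
  haveI : CompactSpace ↥(glInt 2 F) := isCompact_iff_compactSpace.1 (isCompact_glInt 2 F)
  haveI : LocallyCompactSpace (Matrix (Fin 2) (Fin 2) F) := Pi.locallyCompactSpace_of_finite
  haveI : SecondCountableTopology (Matrix (Fin 2) (Fin 2) F) := inferInstanceAs (SecondCountableTopology (Fin 2 → Fin 2 → F))
  haveI : TotallyDisconnectedSpace (Matrix (Fin 2) (Fin 2) F) := inferInstanceAs (TotallyDisconnectedSpace (Fin 2 → Fin 2 → F))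
  haveI : SigmaCompactSpace (Matrix (Fin 2) (Fin 2) F) := inferInstanceAs (SigmaCompactSpace (Fin 2 → Fin 2 → F))
  letI : MeasurableSpace (Matrix (Fin 2) (Fin 2) F) := borel _
  haveI : BorelSpace (Matrix (Fin 2) (Fin 2) F) := ⟨rfl⟩
  haveI : LocallyCompactSpace (Matrix (Fin 2) (Fin 2) F)ᵐᵒᵖ := MulOpposite.opHomeomorph.symm.isClosedEmbedding.locallyCompactSpace
  haveI : SigmaCompactSpace (Matrix (Fin 2) (Fin 2) F)ᵐᵒᵖ := MulOpposite.opHomeomorph.symm.isClosedEmbedding.sigmaCompactSpace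
  haveI : TotallyDisconnectedSpace (Matrix (Fin 2) (Fin 2) F)ᵐᵒᵖ :=
    (MulOpposite.opHomeomorph (M := Matrix (Fin 2) (Fin 2) F)).symm.isEmbedding.isTotallyDisconnected_range.1
      (isTotallyDisconnected_of_totallyDisconnectedSpace _)
  haveI : T2Space (GL (Fin 2) F) := t2Space_generalLinearGroup F 2
  haveI : LocallyCompactSpace (GL (Fin 2) F) := Units.isClosedEmbedding_embedProduct.locallyCompactSpace
  haveI : SigmaCompactSpace (GL (Fin 2) F) := Units.isClosedEmbedding_embedProduct.sigmaCompactSpace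
  haveI : TotallyDisconnectedSpace (GL (Fin 2) F) :=
    Units.isEmbedding_embedProduct.isTotallyDisconnected_range.1 (isTotallyDisconnected_of_totallyDisconnectedSpace _)
  -- the synonym `G = ConjAct (GL (Fin 2) F)` as a topological group
  letI : TopologicalSpace (ConjAct (GL (Fin 2) F)) := (inferInstance : TopologicalSpace (GL (Fin 2) F))
  haveI : IsTopologicalGroup (ConjAct (GL (Fin 2) F)) := (inferInstance : IsTopologicalGroup (GL (Fin 2) F))
  haveI : T2Space (ConjAct (GL (Fin 2) F)) := (inferInstance : T2Space (GL (Fin 2) F))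
  haveI : LocallyCompactSpace (ConjAct (GL (Fin 2) F)) := (inferInstance : LocallyCompactSpace (GL (Fin 2) F))
  haveI : SigmaCompactSpace (ConjAct (GL (Fin 2) F)) := (inferInstance : SigmaCompactSpace (GL (Fin 2) F))
  haveI : TotallyDisconnectedSpace (ConjAct (GL (Fin 2) F)) := (inferInstance : TotallyDisconnectedSpace (GL (Fin 2) F))
  haveI : ContinuousSMul (ConjAct (GL (Fin 2) F)) (Matrix (Fin 2) (Fin 2) F) := by
    refine ⟨?_⟩
    have hc1 : Continuous fun p : ConjAct (GL (Fin 2) F) × Matrix (Fin 2) (Fin 2) F =>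
        ((ConjAct.ofConjAct p.1 : GL (Fin 2) F) : Matrix (Fin 2) (Fin 2) F) := Units.continuous_val.comp continuous_fst
    have hc3 : Continuous fun p : ConjAct (GL (Fin 2) F) × Matrix (Fin 2) (Fin 2) F =>
        (((ConjAct.ofConjAct p.1)⁻¹ : GL (Fin 2) F) : Matrix (Fin 2) (Fin 2) F) := Units.continuous_coe_inv.comp continuous_fst
    exact (hc1.mul continuous_snd).mul hc3
  -- the orbit `X`
  haveI : LocallyCompactSpace ↥(MulAction.orbit (ConjAct (GL (Fin 2) F)) (!![0, 1; 0, 0] : Matrix (Fin 2) (Fin 2) F)) :=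
    locallyCompactSpace_orbit_nilpOne (F := F)
  haveI : ContinuousSMul (ConjAct (GL (Fin 2) F)) ↥(MulAction.orbit (ConjAct (GL (Fin 2) F)) (!![0, 1; 0, 0] : Matrix (Fin 2) (Fin 2) F)) :=
    Literature.MeasureTheory.Group.continuousSMul_orbit _
  have hopen : ∀ x : ↥(MulAction.orbit (ConjAct (GL (Fin 2) F)) (!![0, 1; 0, 0] : Matrix (Fin 2) (Fin 2) F)),
      IsOpenMap fun g : ConjAct (GL (Fin 2) F) => g • x := fun x => isOpenMap_smul_of_sigmaCompact x
  obtain ⟨K₀, hK₀o, hK₀c⟩ := Literature.Topology.Algebra.exists_isCompact_isOpen_subgroup (G := ConjAct (GL (Fin 2) F))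
  -- the invariant Radon measure `μ = val^* ν` (★ S2b)
  haveI := isFiniteMeasureOnCompacts_comap_val (F := F) κ dx
  haveI := smulInvariantMeasure_comap_val (F := F) κ dx
  haveI := Literature.MeasureTheory.Group.isOpenPosMeasure_of_smulInvariantMeasure_ne_zero (G := ConjAct (GL (Fin 2) F))
    (fun x : ↥(MulAction.orbit (ConjAct (GL (Fin 2) F)) (!![0, 1; 0, 0] : Matrix (Fin 2) (Fin 2) F)) =>
      show Continuous fun g : ConjAct (GL (Fin 2) F) => g • x by fun_prop) _ (comap_val_ne_zero (F := F) κ dx)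
  -- the functional `T̄` on `S(X)`: `T` of an extension off `0`
  obtain ⟨Tbar, hTbar_def⟩ : ∃ Tbar : (↥(MulAction.orbit (ConjAct (GL (Fin 2) F)) (!![0, 1; 0, 0] : Matrix (Fin 2) (Fin 2) F)) → ℂ) → ℂ,
      ∀ φ, Tbar φ = if h : IsLocallyConstant φ ∧ HasCompactSupport φ then
        T (Classical.choose (exists_isLocSmooth_extend_off_zero φ h.1 h.2)) else 0 := ⟨_, fun _ => rfl⟩
  have hTbar : ∀ φ : ↥(MulAction.orbit (ConjAct (GL (Fin 2) F)) (!![0, 1; 0, 0] : Matrix (Fin 2) (Fin 2) F)) → ℂ,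
      IsLocallyConstant φ → HasCompactSupport φ → ∀ Φ : Matrix (Fin 2) (Fin 2) F → ℂ, IsLocSmooth Φ → (0 : Matrix (Fin 2) (Fin 2) F) ∉ tsupport Φ →
      (∀ x : ↥(MulAction.orbit (ConjAct (GL (Fin 2) F)) (!![0, 1; 0, 0] : Matrix (Fin 2) (Fin 2) F)), Φ (x : Matrix (Fin 2) (Fin 2) F) = φ x) →
      Tbar φ = T Φ := by
    intro φ hφ hφs Φ hΦ hΦ0 hΦφ
    have h : IsLocallyConstant φ ∧ HasCompactSupport φ := ⟨hφ, hφs⟩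
    rw [hTbar_def, dif_pos h]
    obtain ⟨hE, hE0, hEφ⟩ := Classical.choose_spec (exists_isLocSmooth_extend_off_zero φ h.1 h.2)
    exact apply_eq_apply_of_forall_comp_val_eq hT1 hT4 hE hΦ hE0 hΦ0 fun x => by rw [hEφ, hΦφ]
  -- `T̄` is additive, homogeneous and `G`-invariant on `S(X)` (clauses (i), (ii), (iii))
  have hadd : ∀ φ ψ : ↥(MulAction.orbit (ConjAct (GL (Fin 2) F)) (!![0, 1; 0, 0] : Matrix (Fin 2) (Fin 2) F)) → ℂ,
      IsLocallyConstant φ → HasCompactSupport φ → IsLocallyConstant ψ → HasCompactSupport ψ → Tbar (φ + ψ) = Tbar φ + Tbar ψ := by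
    intro φ ψ hφ hφs hψ hψs
    obtain ⟨Φ, hΦ, hΦ0, hΦφ⟩ := exists_isLocSmooth_extend_off_zero φ hφ hφs
    obtain ⟨Ψ, hΨ, hΨ0, hΨψ⟩ := exists_isLocSmooth_extend_off_zero ψ hψ hψs
    have h0 : (0 : Matrix (Fin 2) (Fin 2) F) ∉ tsupport (Φ + Ψ) := by
      rw [notMem_tsupport_iff_eventuallyEq] at hΦ0 hΨ0 ⊢
      exact (hΦ0.and hΨ0).mono fun Y hY => by
        simp only [Pi.add_apply, Pi.zero_apply] at hY ⊢
        rw [hY.1, hY.2, add_zero]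
    rw [hTbar (φ + ψ) (hφ.add hψ) (hφs.add hψs) (Φ + Ψ) (hΦ.add hΨ) h0 (fun x => by simp only [Pi.add_apply, hΦφ, hΨψ]),
      hTbar φ hφ hφs Φ hΦ hΦ0 hΦφ, hTbar ψ hψ hψs Ψ hΨ hΨ0 hΨψ]
    exact hT1 Φ Ψ hΦ hΨ
  have hsmul : ∀ (a : ℂ) (φ : ↥(MulAction.orbit (ConjAct (GL (Fin 2) F)) (!![0, 1; 0, 0] : Matrix (Fin 2) (Fin 2) F)) → ℂ),
      IsLocallyConstant φ → HasCompactSupport φ → Tbar (a • φ) = a * Tbar φ := by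
    intro a φ hφ hφs
    obtain ⟨Φ, hΦ, hΦ0, hΦφ⟩ := exists_isLocSmooth_extend_off_zero φ hφ hφs
    have h0 : (0 : Matrix (Fin 2) (Fin 2) F) ∉ tsupport (a • Φ) := by
      rw [notMem_tsupport_iff_eventuallyEq] at hΦ0 ⊢
      exact hΦ0.mono fun Y hY => by
        simp only [Pi.smul_apply, Pi.zero_apply, smul_eq_mul] at hY ⊢
        rw [hY, mul_zero]
    rw [hTbar (a • φ) (hφ.comp fun z => a • z) hφs.smul_left (a • Φ) (hΦ.const_smul a) h0 (fun x => by simp only [Pi.smul_apply, hΦφ]),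
      hTbar φ hφ hφs Φ hΦ hΦ0 hΦφ]
    exact hT2 a Φ hΦ
  have hinv : ∀ φ : ↥(MulAction.orbit (ConjAct (GL (Fin 2) F)) (!![0, 1; 0, 0] : Matrix (Fin 2) (Fin 2) F)) → ℂ,
      IsLocallyConstant φ → HasCompactSupport φ → ∀ g : ConjAct (GL (Fin 2) F), Tbar (fun y => φ (g • y)) = Tbar φ := by
    intro φ hφ hφs g
    obtain ⟨Φ, hΦ, hΦ0, hΦφ⟩ := exists_isLocSmooth_extend_off_zero φ hφ hφs
    -- the extension `Φ ∘ Ad(g)` of `φ ∘ (g • ·)`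
    have hc := continuous_conj (F := F) (ConjAct.ofConjAct g)
    have hΦ' : IsLocSmooth fun Y : Matrix (Fin 2) (Fin 2) F => Φ (((ConjAct.ofConjAct g : GL (Fin 2) F) : Matrix (Fin 2) (Fin 2) F) * Y *
        (((ConjAct.ofConjAct g)⁻¹ : GL (Fin 2) F) : Matrix (Fin 2) (Fin 2) F)) :=
      ⟨hΦ.1.comp_continuous hc, hΦ.2.comp_homeomorph (Homeomorph.smul g)⟩
    have hΦ'0 : (0 : Matrix (Fin 2) (Fin 2) F) ∉ tsupport fun Y : Matrix (Fin 2) (Fin 2) F =>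
        Φ (((ConjAct.ofConjAct g : GL (Fin 2) F) : Matrix (Fin 2) (Fin 2) F) * Y * (((ConjAct.ofConjAct g)⁻¹ : GL (Fin 2) F) : Matrix (Fin 2) (Fin 2) F)) := by
      rw [notMem_tsupport_iff_eventuallyEq] at hΦ0 ⊢
      have ht : Tendsto (fun Y : Matrix (Fin 2) (Fin 2) F => ((ConjAct.ofConjAct g : GL (Fin 2) F) : Matrix (Fin 2) (Fin 2) F) * Y *
          (((ConjAct.ofConjAct g)⁻¹ : GL (Fin 2) F) : Matrix (Fin 2) (Fin 2) F)) (𝓝 0) (𝓝 0) := by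
        simpa only [Matrix.mul_zero, Matrix.zero_mul] using hc.tendsto (0 : Matrix (Fin 2) (Fin 2) F)
      exact ht.eventually hΦ0
    rw [hTbar (fun y => φ (g • y)) (hφ.comp_continuous (continuous_const_smul g)) (hφs.comp_homeomorph (Homeomorph.smul g)) _ hΦ' hΦ'0
        (fun x => by rw [← hΦφ (g • x), MulAction.orbit.coe_smul, ConjAct.units_smul_def]),
      hTbar φ hφ hφs Φ hΦ hΦ0 hΦφ]
    exact hT3 (ConjAct.ofConjAct g) Φ hΦ
  -- ★ COINV-1: `T̄ = c·μ` on `S(X)`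
  obtain ⟨c, hc⟩ := Literature.MeasureTheory.Group.exists_forall_apply_eq_const_mul_integral_of_smul_invariant_of_additive K₀ hK₀o hK₀c hopen
    (Measure.comap (Subtype.val : ↥(MulAction.orbit (ConjAct (GL (Fin 2) F)) (!![0, 1; 0, 0] : Matrix (Fin 2) (Fin 2) F)) → Matrix (Fin 2) (Fin 2) F)
      ((κ.prod dx).map fun p : ↥(glInt 2 F) × F =>
        ((p.1 : GL (Fin 2) F) : Matrix (Fin 2) (Fin 2) F) * !![0, p.2; 0, 0] * ((((p.1 : GL (Fin 2) F))⁻¹ : GL (Fin 2) F) : Matrix (Fin 2) (Fin 2) F)))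
    Tbar hadd hsmul hinv
  refine ⟨c, fun f hf hf0 => ?_⟩
  -- transfer: `f` is its own extension of `f ∘ val ∈ S(X)`
  have hφ : IsLocallyConstant fun x : ↥(MulAction.orbit (ConjAct (GL (Fin 2) F)) (!![0, 1; 0, 0] : Matrix (Fin 2) (Fin 2) F)) =>
      f (x : Matrix (Fin 2) (Fin 2) F) := hf.1.comp_continuous continuous_subtype_val
  have hφs := hasCompactSupport_comp_val hf hf0
  have key := hTbar _ hφ hφs f hf hf0 fun _ => rfl
  have hc' : Tbar (fun x : ↥(MulAction.orbit (ConjAct (GL (Fin 2) F)) (!![0, 1; 0, 0] : Matrix (Fin 2) (Fin 2) F)) => f (x : Matrix (Fin 2) (Fin 2) F)) =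
      c * ∫ x : ↥(MulAction.orbit (ConjAct (GL (Fin 2) F)) (!![0, 1; 0, 0] : Matrix (Fin 2) (Fin 2) F)), f (x : Matrix (Fin 2) (Fin 2) F) ∂(Measure.comap
        (Subtype.val : ↥(MulAction.orbit (ConjAct (GL (Fin 2) F)) (!![0, 1; 0, 0] : Matrix (Fin 2) (Fin 2) F)) → Matrix (Fin 2) (Fin 2) F)
        ((κ.prod dx).map fun p : ↥(glInt 2 F) × F =>
          ((p.1 : GL (Fin 2) F) : Matrix (Fin 2) (Fin 2) F) * !![0, p.2; 0, 0] * ((((p.1 : GL (Fin 2) F))⁻¹ : GL (Fin 2) F) : Matrix (Fin 2) (Fin 2) F))) :=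
    hc _ hφ hφs
  rw [← key, hc', integral_comp_val_comap_val κ dx hf.continuous.aestronglyMeasurable]

/-! ## §3  (LBGL-2a): the structure of `J(𝒩)(𝔤𝔩₂(F))` -/

/-- **(LBGL-2a) for a given Haar pair**: every `T` with the four `J(𝒩)` clauses is `a·δ₀ + b·μ_reg^{κ,dx}` on `C_c^∞(𝔤𝔩₂(F))` (§2 + ★ p856851
`gl2_nilpotentStructure_of_puncturedCone`). [cite: HarishChandra1999AdmissibleDistributions, Thm. 3.9, Cor. 3.10 p. 10] [cite: Howe1974, Prop. 2] -/
theorem gl2_nilpotentStructure' [MeasurableSpace F] [BorelSpace F] [MeasurableSpace (GL (Fin 2) F)] [BorelSpace (GL (Fin 2) F)]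
    (κ : Measure ↥(glInt 2 F)) [IsHaarMeasure κ] (dx : Measure F) [dx.IsAddHaarMeasure]
    (T : (Matrix (Fin 2) (Fin 2) F → ℂ) → ℂ)
    (hT : (∀ f₁ f₂ : Matrix (Fin 2) (Fin 2) F → ℂ, IsLocSmooth f₁ → IsLocSmooth f₂ → T (f₁ + f₂) = T f₁ + T f₂) ∧
       (∀ (a : ℂ) (f : Matrix (Fin 2) (Fin 2) F → ℂ), IsLocSmooth f → T (a • f) = a * T f) ∧
       (∀ (x : GL (Fin 2) F) (f : Matrix (Fin 2) (Fin 2) F → ℂ), IsLocSmooth f →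
          T (fun X => f ((x : Matrix (Fin 2) (Fin 2) F) * X * ((x⁻¹ : GL (Fin 2) F) : Matrix (Fin 2) (Fin 2) F))) = T f) ∧
       (∀ f : Matrix (Fin 2) (Fin 2) F → ℂ, IsLocSmooth f → (∀ X ∈ tsupport f, ¬ IsNilpotent X) → T f = 0)) :
    ∃ a b : ℂ, ∀ f : Matrix (Fin 2) (Fin 2) F → ℂ, IsLocSmooth f →
      T f = a * f 0 + b * ∫ p : ↥(glInt 2 F) × F, f (((p.1 : GL (Fin 2) F) : Matrix (Fin 2) (Fin 2) F) * !![0, p.2; 0, 0] *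
        ((((p.1 : GL (Fin 2) F))⁻¹ : GL (Fin 2) F) : Matrix (Fin 2) (Fin 2) F)) ∂(κ.prod dx) :=
  gl2_nilpotentStructure_of_puncturedCone κ dx T hT.1 hT.2.1 (gl2_nilpotentUniqueness_off_zero κ dx T hT)

/-- **(LBGL-2a) `sig_K2E3GL2NilpotentStructure` — STRUCTURE OF `J(𝒩)(𝔤𝔩₂(F))`**, the U12 ED. 8 leaf TOKEN FOR TOKEN: every distribution `T` on `C_c^∞(𝔤𝔩₂(F))`
that is additive, homogeneous, `Ad(GL₂(F))`-invariant and supported on the nilpotent cone is `a·δ₀ + b·μ_reg`, `μ_reg(f) = ∫_{GL₂(𝒪_F) × F} f(k · tE₁₂ · k⁻¹) d(κ ⊗ dx)`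
for a Haar pair `(κ, dx)` (★ p856734: `μ_reg ∈ J(𝒩) ∖ ℂδ₀`).  `dim J(𝒩)(𝔤𝔩₂)` = number of nilpotent orbits = 2.
[cite: HarishChandra1999AdmissibleDistributions, §3 Thm. 3.9, Cor. 3.10 p. 10] [cite: Howe1974, Prop. 2] [cite: BernsteinZelevinsky1976, §1.18] -/
theorem gl2_nilpotentStructure :
    ∀ (F : Type) [Field F] [ValuativeRel F] [TopologicalSpace F] [IsNonarchimedeanLocalField F] [CharZero F]
      [MeasurableSpace F] [BorelSpace F] [MeasurableSpace (GL (Fin 2) F)] [BorelSpace (GL (Fin 2) F)]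
      (κ : Measure ↥(glInt 2 F)) [IsHaarMeasure κ] (dx : Measure F) [dx.IsAddHaarMeasure],
      ∀ T : (Matrix (Fin 2) (Fin 2) F → ℂ) → ℂ,
        ((∀ f₁ f₂ : Matrix (Fin 2) (Fin 2) F → ℂ, IsLocSmooth f₁ → IsLocSmooth f₂ → T (f₁ + f₂) = T f₁ + T f₂) ∧
         (∀ (a : ℂ) (f : Matrix (Fin 2) (Fin 2) F → ℂ), IsLocSmooth f → T (a • f) = a * T f) ∧
         (∀ (x : GL (Fin 2) F) (f : Matrix (Fin 2) (Fin 2) F → ℂ), IsLocSmooth f →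
            T (fun X => f ((x : Matrix (Fin 2) (Fin 2) F) * X * ((x⁻¹ : GL (Fin 2) F) : Matrix (Fin 2) (Fin 2) F))) = T f) ∧
         (∀ f : Matrix (Fin 2) (Fin 2) F → ℂ, IsLocSmooth f → (∀ X ∈ tsupport f, ¬ IsNilpotent X) → T f = 0)) →
        ∃ a b : ℂ, ∀ f : Matrix (Fin 2) (Fin 2) F → ℂ, IsLocSmooth f →
          T f = a * f 0 + b * ∫ p : ↥(glInt 2 F) × F, f (((p.1 : GL (Fin 2) F) : Matrix (Fin 2) (Fin 2) F) * !![0, p.2; 0, 0] *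
            ((((p.1 : GL (Fin 2) F))⁻¹ : GL (Fin 2) F) : Matrix (Fin 2) (Fin 2) F)) ∂(κ.prod dx) := by
  intro F _ _ _ _ _ _ _ _ _ κ _ dx _ T hT
  exact gl2_nilpotentStructure' κ dx T hT

end Summit.HodgeConjecture.HodgeConjecture.Cruxes.H413.K2E3GL2NilpotentOneOrbitUniqueness
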